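import Literature.Analysis.FluidPDE.AdaptedBackwardKernel
import Literature.Analysis.FluidPDE.SpaceTimeCalculusC1
import HarnessLib.Audit

/-!
# `FrequencyRigidity` (crux `stmt-NavierStokesRegularity-2955`): Galilean covariance of flow-adapted
# backward kernels — negative-side support (refuter, drefute g2)

The crux's informal statement is designed "(i) invariant under the generalized Galilei wobble
`v(x − B(t), t) + B′(t)` — to which `H` and `Λ` are blind".  This file kernel-checks the kernel half
of that design claim, for adapted kernels on `(−∞, T)` with pole `(T, x₀)` over any
finite-dimensional inner-product space:

* `isAdaptedBackwardKernel_wobble`: if `G` is adapted to the drift `u` and `B` is a `C²` path on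
  `(−∞, T)` with velocity `B′` and `B(t) → 0` as `t ↑ T`, then `G̃(t,x) = G(t, x − B(t))` is adapted,
  with the SAME pole, to the wobbled drift `ũ(t,x) = u(t, x − B(t)) + B′(t)`: the adjoint equation
  `∂ₜG + u·∇G + νΔG = 0` is covariant (`∂ₜG̃ = ∂ₜG − DG·B′`, `DG̃·ũ = DG·u + DG·B′`), unit mass is
  translation invariant, and concentration at `x₀` survives because the shift vanishes at the pole
  (tightness from clause (5) with a continuous cut-off, continuity of the test function at `x₀`).
* `isGaussianComparable_wobble`: two-sided Gaussian comparability about `(T, x₀)` is preserved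
  whenever `‖B(t)‖² ≤ β(T − t)` — automatic for a TYPE-I wobble (`‖B′‖ ≤ C_B/√(T−t)`, `B(T) = 0`),
  which is exactly the class that also preserves the crux's Type-I bound; constants
  `(c₁e^{−2β/c₂}, c₂/2, C₁e^{β/C₂}, 2C₂)`.
* The model case with TRANSPORT (`isAdaptedBackwardKernel_parasiticDrift`,
  `isGaussianComparable_parasiticDrift`): wobbling the backward heat kernel of the zero drift by the
  parabolic shift `B(t) = 2b√(T−t)e` gives the translating kernel `Γ_{ν(T−t)}(x − 2b√(T−t)e − x₀)`,
  adapted and comparable for the parasitic Type-I drift `v ≡ B′(t) = −(b/√(T−t))e` (KNSS's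
  "parasitic solutions" `u = b(t)`, `p = −b′(t)·x`).  Its `ℝ³` packaging with `DK·v ≠ 0` is in
  `Negative/DriftKernelWitness.lean` (non-vacuity of Stub 2b's hypotheses WITH transport).

Uses for the crux programme: normal forms may fix the Galilean gauge of a witness (e.g. centre the
kernel) without leaving the witness class; line `kernel-fading-memory`'s `stub_kernelCentring` and
the route item `AdaptedKernelExists` can import the covariance instead of re-deriving it.
No `¬`-theorem of a Theses decl is claimed; nothing here asserts a route statement positively.

## References

* G. Koch, N. Nadirashvili, G. Seregin, V. Šverák, Acta Math. 203 (2009) 83–105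
  (arXiv:0709.3599), p. 3 (parasitic solutions) and §3 Lemma 3.1. [KochNadirashviliSereginSverak2009]
* A. Friedman, *Partial Differential Equations of Parabolic Type* (1964), Ch. 1 §8 (adjoint
  equation). [Friedman1964]
-/

noncomputable section

set_option linter.dupNamespace false

namespace Summit.NavierStokesRegularity.NavierStokesRegularity.Theorems.FrequencyRigidity.Negative

open Literature.Analysis.FluidPDE Literature.Analysis.UnboundedOperators
open MeasureTheory Set Filter Topology Function
open scoped Laplacian InnerProductSpace RealInnerProductSpace ContDiff

section Kinematics

variable {E : Type*} [NormedAddCommGroup E] [NormedSpace ℝ E]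

/-- **Galilean wobble of a drift**: `ũ(t, x) = u(t, x − B(t)) + B′(t)`. -/
def wobbleDrift (u : ℝ → E → E) (B B' : ℝ → E) (t : ℝ) (x : E) : E := u t (x - B t) + B' t

/-- **Galilean wobble of a kernel** (or of any scalar): `G̃(t, x) = G(t, x − B(t))`. -/
def wobbleKernel (G : ℝ → E → ℝ) (B : ℝ → E) (t : ℝ) (x : E) : ℝ := G t (x - B t)

/-- Chain rule along a moving point: if `s ↦ c s` has velocity `w` at `t` and `c t = y`, then
`s ↦ A s (c s)` has derivative `L (1, 0) + L (0, w)` at `t` (`L = D(uncurry A)(t, y)`). -/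
theorem hasDerivAt_along' {F : Type*} [NormedAddCommGroup F] [NormedSpace ℝ F]
    {A : ℝ → E → F} {t : ℝ} {y : E} {L : ℝ × E →L[ℝ] F}
    (hA : HasFDerivAt (uncurry A) L (t, y)) {c : ℝ → E} {w : E}
    (hc : HasDerivAt c w t) (hct : c t = y) :
    HasDerivAt (fun s => A s (c s)) (L (1, 0) + L (0, w)) t := by
  have hγ : HasDerivAt (fun s => (s, c s)) (1, w) t := (hasDerivAt_id t).prodMk hc
  have hA' : HasFDerivAt (uncurry A) L ((fun s => (s, c s)) t) := by simpa only [hct] using hA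
  have h := hA'.comp_hasDerivAt t hγ
  have hsum : L (1, w) = L (1, 0) + L (0, w) := by
    rw [← map_add, Prod.mk_add_mk, add_zero, zero_add]
  rw [← hsum]
  exact h

omit [NormedSpace ℝ E] in
/-- The wobble of the zero drift is the spatially constant drift `B′(t)`. -/
theorem wobbleDrift_zero (B B' : ℝ → E) :
    wobbleDrift (0 : ℝ → E → E) B B' = fun t _ => B' t := by
  funext t x; simp [wobbleDrift]

/-- The parabolic shift `B(t) = 2b√(T−t) e` (so that `B(T) = 0`). -/
def parabolicShift (T b : ℝ) (e : E) (t : ℝ) : E := (2 * b * Real.sqrt (T - t)) • e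

/-- Its velocity, the **parasitic Type-I drift** `B′(t) = −(b/√(T−t)) e`. -/
def parasiticDrift (T b : ℝ) (e : E) (t : ℝ) : E := (-(b / Real.sqrt (T - t))) • e

/-- `B′ = ` the parasitic drift. -/
theorem hasDerivAt_parabolicShift (b : ℝ) (e : E) {T t : ℝ} (ht : t < T) :
    HasDerivAt (parabolicShift T b e) (parasiticDrift T b e t) t := by
  have hTt : 0 < T - t := sub_pos.2 ht
  have hs : HasDerivAt (fun s => Real.sqrt (T - s)) ((0 - 1) / (2 * Real.sqrt (T - t))) t :=
    ((hasDerivAt_const t T).sub (hasDerivAt_id t)).sqrt hTt.ne'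
  have h := ((hs.const_mul (2 * b)).smul_const e)
  refine h.congr_deriv ?_
  simp only [parasiticDrift]
  congr 1
  have : Real.sqrt (T - t) ≠ 0 := (Real.sqrt_pos.2 hTt).ne'
  field_simp
  ring

/-- The parabolic shift is smooth before the pole. -/
theorem contDiffOn_parabolicShift (T b : ℝ) (e : E) {n : WithTop ℕ∞} :
    ContDiffOn ℝ n (parabolicShift T b e) (Iio T) :=
  ((contDiffOn_const.mul ((contDiffOn_const.sub contDiffOn_id).sqrt
    fun t ht => (sub_pos.2 (show t < T from ht)).ne')).smul contDiffOn_const)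

/-- The parabolic shift vanishes at the pole. -/
theorem tendsto_parabolicShift (T b : ℝ) (e : E) :
    Tendsto (parabolicShift T b e) (𝓝[<] T) (𝓝 0) := by
  have hc : Continuous (parabolicShift T b e) :=
    (continuous_const.mul ((continuous_const.sub continuous_id).sqrt)).smul continuous_const
  have h0 : parabolicShift T b e T = 0 := by simp [parabolicShift]
  simpa [h0] using (hc.tendsto T).mono_left nhdsWithin_le_nhds

/-- `‖B(t)‖² = 4b²‖e‖²(T − t)`: the shift lives on the parabolic scale. -/
theorem norm_parabolicShift_sq (T b : ℝ) (e : E) {t : ℝ} (ht : t < T) :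
    ‖parabolicShift T b e t‖ ^ 2 = 4 * b ^ 2 * ‖e‖ ^ 2 * (T - t) := by
  have hTt : 0 ≤ T - t := (sub_pos.2 ht).le
  rw [parabolicShift, norm_smul, mul_pow, Real.norm_eq_abs, sq_abs, mul_pow, mul_pow,
    Real.sq_sqrt hTt]
  ring

end Kinematics

section Wobble

variable {E : Type*} [NormedAddCommGroup E] [InnerProductSpace ℝ E] [FiniteDimensional ℝ E]
  [MeasurableSpace E] [BorelSpace E]

omit [MeasurableSpace E] [BorelSpace E] in
/-- Translation invariance of the Laplacian, `Δ(f(· − a))(x) = (Δf)(x − a)`. -/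
theorem laplacian_comp_sub_const' (f : E → ℝ) (a x : E) :
    (Δ (fun y => f (y - a))) x = (Δ f) (x - a) := by
  rw [InnerProductSpace.laplacian_eq_iteratedFDeriv_stdOrthonormalBasis,
    InnerProductSpace.laplacian_eq_iteratedFDeriv_stdOrthonormalBasis]
  simp only [iteratedFDeriv_comp_sub]

variable {ν T : ℝ} {u : ℝ → E → E} {G : ℝ → E → ℝ} {B B' : ℝ → E} {x₀ : E}

/-- **Galilean covariance of flow-adapted backward kernels.**  If `G` is an adapted backward kernel
of `∂ₜ + u·∇ − νΔ` on `(−∞, T)` with pole `(T, x₀)`, and `B` is a `C²` path on `(−∞, T)` with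
velocity `B′` and `B(t) → 0` as `t ↑ T`, then `G̃(t, x) = G(t, x − B(t))` is an adapted backward
kernel, with the same pole, of the wobbled drift `ũ(t, x) = u(t, x − B(t)) + B′(t)`:
`∂ₜG̃ = ∂ₜG − DG·B′` and `DG̃·ũ = DG·u + DG·B′` at the shifted point, so the adjoint equation is
covariant; unit mass is translation invariant; and concentration at `x₀` survives because the
shift vanishes at the pole (tightness of `G(t, ·)` near `T` from clause (5) with a continuous
cut-off, continuity of the test function at `x₀`). -/
theorem isAdaptedBackwardKernel_wobble (hG : IsAdaptedBackwardKernel ν u (Iio T) T x₀ G)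
    (hB : ContDiffOn ℝ 2 B (Iio T)) (hB' : ∀ t < T, HasDerivAt B (B' t) t)
    (hB0 : Tendsto B (𝓝[<] T) (𝓝 0)) :
    IsAdaptedBackwardKernel ν (wobbleDrift u B B') (Iio T) T x₀ (wobbleKernel G B) where
  contDiffOn := by
    have hmap : ContDiffOn ℝ 2 (fun p : ℝ × E => (p.1, p.2 - B p.1)) (Iio T ×ˢ univ) :=
      contDiffOn_fst.prodMk (contDiffOn_snd.sub (hB.comp contDiffOn_fst fun p hp => hp.1))
    refine (hG.contDiffOn.comp hmap fun p hp => ⟨hp.1, mem_univ _⟩).congr fun p _ => ?_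
    rfl
  pos t ht x := hG.pos t ht _
  adjoint_eq t ht x := by
    have ht' : Iio T ∈ 𝓝 t := Iio_mem_nhds ht
    set y : E := x - B t with hy
    have h1 : ContDiffOn ℝ 1 (uncurry G) (Iio T ×ˢ univ) := hG.contDiffOn.of_le one_le_two
    set L : ℝ × E →L[ℝ] ℝ := fderiv ℝ (uncurry G) (t, y) with hL
    have hGd : HasFDerivAt (uncurry G) L (t, y) := hasFDerivAt_uncurry_of_contDiffOn h1 ht' y
    -- time derivative of the wobbled kernel
    have hc : HasDerivAt (fun s => x - B s) (-B' t) t := by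
      simpa using (hB' t ht).const_sub x
    have htime : HasDerivAt (fun s => wobbleKernel G B s x) (L (1, 0) + L (0, -B' t)) t :=
      hasDerivAt_along' hGd hc rfl
    have hdt : timeDerivWithin (Iio T) (wobbleKernel G B) t x = L (1, 0) + L (0, -B' t) := by
      rw [timeDerivWithin_apply, derivWithin_of_mem_nhds ht']
      exact htime.deriv
    -- partial derivatives of `G` at `(t, y)` in terms of `L`
    have hGt : timeDerivWithin (Iio T) G t y = L (1, 0) :=
      timeDerivWithin_eq_fderiv_of_contDiffOn h1 ht' y
    have hGx : ∀ h : E, fderiv ℝ (G t) y h = L (0, h) := fun h => by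
      rw [(hasFDerivAt_slice_of_contDiffOn h1 ht' y).fderiv]
      rfl
    -- spatial derivatives of the wobbled slice
    have hDx : fderiv ℝ (wobbleKernel G B t) x = fderiv ℝ (G t) y := by
      show fderiv ℝ (fun z => G t (z - B t)) x = _
      rw [fderiv_comp_sub]
    have hΔ : (Δ (wobbleKernel G B t)) x = (Δ (G t)) y := by
      show (Δ (fun z => G t (z - B t))) x = _
      rw [laplacian_comp_sub_const']
    have h0 := hG.adjoint_eq t ht y
    rw [hdt, hDx, hΔ, wobbleDrift, map_add (fderiv ℝ (G t) y), hGx (B' t), ← hGt]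
    have hneg : L (0, -B' t) = -L (0, B' t) := by
      rw [← map_neg, Prod.neg_mk, neg_zero]
    rw [hneg]
    linear_combination h0
  integral_eq_one t ht := by
    show ∫ x, G t (x - B t) = 1
    rw [integral_sub_right_eq_self (fun x => G t x) (B t)]
    exact hG.integral_eq_one t ht
  tendsto_integral_mul φ hφ hM := by
    obtain ⟨M, hM⟩ := hM
    have hM0 : 0 ≤ M := (abs_nonneg _).trans (hM x₀)
    -- substitution `x ↦ y + B t`
    have hsub : ∀ t, (∫ x, φ x * wobbleKernel G B t x) = ∫ y, φ (y + B t) * G t y := fun t => by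
      rw [← integral_sub_right_eq_self (fun y => φ (y + B t) * G t y) (B t)]
      simp only [sub_add_cancel]
      rfl
    simp_rw [hsub]
    -- integrability of `f · G(t)` for bounded continuous `f`
    have hint : ∀ {t}, t < T → ∀ (f : E → ℝ), Continuous f → (∀ y, |f y| ≤ M ∨ |f y| ≤ 1) →
        ∀ C : ℝ, (∀ y, |f y| ≤ C) → Integrable (fun y => f y * G t y) := by
      intro t ht f hf _ C hC
      exact (hG.integrable ht).bdd_mul hf.aestronglyMeasurable
        (Eventually.of_forall fun y => by rw [Real.norm_eq_abs]; exact hC y)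
    rw [Metric.tendsto_nhds]
    intro ε hε
    set ε' : ℝ := ε / 4 with hε'
    have hε'0 : 0 < ε' := by positivity
    -- continuity of `φ` at the pole
    obtain ⟨δ, hδ, hδφ⟩ := Metric.continuousAt_iff.1 hφ.continuousAt ε' hε'0
    -- continuous cut-off vanishing at the pole, `= 1` off `B(x₀, δ/2)`
    set ρ : E → ℝ := fun y => min 1 (2 / δ * dist y x₀) with hρ
    have hρc : Continuous ρ := continuous_const.min (continuous_const.mul (continuous_id.dist continuous_const))
    have hρ0 : ∀ y, 0 ≤ ρ y := fun y => le_min zero_le_one (by positivity)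
    have hρ1 : ∀ y, ρ y ≤ 1 := fun y => min_le_left _ _
    have hρb : ∀ y, |ρ y| ≤ 1 := fun y => by rw [abs_of_nonneg (hρ0 y)]; exact hρ1 y
    have hρx₀ : ρ x₀ = 0 := by simp [hρ]
    have hρfar : ∀ y, δ / 2 ≤ dist y x₀ → ρ y = 1 := fun y hy => by
      refine min_eq_left ?_
      rw [div_mul_eq_mul_div, le_div_iff₀ hδ]
      linarith
    -- pointwise bound on the integrand difference when the shift is small
    have hpt : ∀ t, dist (B t) 0 < δ / 2 → ∀ y,
        |φ (y + B t) - φ y| ≤ 2 * ε' + 2 * M * ρ y := by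
      intro t hBt y
      rcases lt_or_ge (dist y x₀) (δ / 2) with hy | hy
      · have h1 : dist (y + B t) x₀ < δ := by
          calc dist (y + B t) x₀ ≤ dist (y + B t) y + dist y x₀ := dist_triangle _ _ _
            _ = dist (B t) 0 + dist y x₀ := by simp [dist_eq_norm]
            _ < δ / 2 + δ / 2 := add_lt_add hBt hy
            _ = δ := by ring
        have h2 : dist (φ (y + B t)) (φ x₀) < ε' := hδφ h1
        have h3 : dist (φ y) (φ x₀) < ε' := hδφ (by linarith)
        rw [Real.dist_eq] at h2 h3
        have : 0 ≤ 2 * M * ρ y := by have := hρ0 y; positivity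
        calc |φ (y + B t) - φ y| = |(φ (y + B t) - φ x₀) - (φ y - φ x₀)| := by ring_nf
          _ ≤ |φ (y + B t) - φ x₀| + |φ y - φ x₀| := abs_sub _ _
          _ ≤ 2 * ε' + 2 * M * ρ y := by linarith
      · rw [hρfar y hy]
        calc |φ (y + B t) - φ y| ≤ |φ (y + B t)| + |φ y| := abs_sub _ _
          _ ≤ M + M := add_le_add (hM _) (hM _)
          _ ≤ 2 * ε' + 2 * M * 1 := by linarith
    -- the three eventualities
    have e1 := Metric.tendsto_nhds.1 (hG.tendsto_integral_mul φ hφ ⟨M, hM⟩) ε' hε'0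
    have e2 := Metric.tendsto_nhds.1 (hG.tendsto_integral_mul ρ hρc ⟨1, hρb⟩) (ε' / (2 * M + 1))
      (by positivity)
    have e3 := Metric.tendsto_nhds.1 hB0 (δ / 2) (by positivity)
    have e4 : ∀ᶠ t in 𝓝[<] T, t < T := self_mem_nhdsWithin
    filter_upwards [e1, e2, e3, e4] with t h1 h2 h3 h4
    have hIφ := hint h4 φ hφ (fun y => Or.inl (hM y)) M hM
    have hIρ := hint h4 ρ hρc (fun y => Or.inr (hρb y)) 1 hρb
    have hIφB : Integrable (fun y => φ (y + B t) * G t y) :=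
      hint h4 (fun y => φ (y + B t)) (hφ.comp (continuous_id.add continuous_const))
        (fun y => Or.inl (hM _)) M (fun y => hM _)
    -- `|∫ φ(· + B t) G − ∫ φ G| ≤ 2ε' + 2M ∫ ρ G`
    have hdiff : |(∫ y, φ (y + B t) * G t y) - ∫ y, φ y * G t y| ≤
        2 * ε' + 2 * M * ∫ y, ρ y * G t y := by
      rw [← integral_sub hIφB hIφ]
      have hbound : ∀ y, ‖φ (y + B t) * G t y - φ y * G t y‖ ≤ (2 * ε' + 2 * M * ρ y) * G t y :=
        fun y => by
          rw [← sub_mul, norm_mul, Real.norm_eq_abs, Real.norm_eq_abs, abs_of_pos (hG.pos t h4 y)]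
          exact mul_le_mul_of_nonneg_right (hpt t h3 y) (hG.pos t h4 y).le
      have hIb : Integrable (fun y => (2 * ε' + 2 * M * ρ y) * G t y) := by
        have : (fun y => (2 * ε' + 2 * M * ρ y) * G t y) =
            fun y => (2 * ε') * G t y + (2 * M) * (ρ y * G t y) := by
          funext y; ring
        rw [this]
        exact ((hG.integrable h4).const_mul _).add (hIρ.const_mul _)
      have h := norm_integral_le_of_norm_le hIb (Eventually.of_forall hbound)
      rw [Real.norm_eq_abs] at h
      refine h.trans (le_of_eq ?_)
      have : (fun y => (2 * ε' + 2 * M * ρ y) * G t y) =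
          fun y => (2 * ε') * G t y + (2 * M) * (ρ y * G t y) := by
        funext y; ring
      rw [this, integral_add ((hG.integrable h4).const_mul _) (hIρ.const_mul _), integral_const_mul,
        integral_const_mul, hG.integral_eq_one t h4, mul_one]
    -- `2M ∫ ρ G < ε'`
    have hρint0 : 0 ≤ ∫ y, ρ y * G t y :=
      integral_nonneg fun y => mul_nonneg (hρ0 y) (hG.pos t h4 y).le
    have h2' : (∫ y, ρ y * G t y) < ε' / (2 * M + 1) := by
      rw [hρx₀, Real.dist_eq, sub_zero, abs_of_nonneg hρint0] at h2
      exact h2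
    have h2'' : 2 * M * ∫ y, ρ y * G t y < ε' := by
      have hden : 0 < 2 * M + 1 := by positivity
      rw [lt_div_iff₀ hden] at h2'
      nlinarith
    rw [Real.dist_eq] at h1 ⊢
    calc |(∫ y, φ (y + B t) * G t y) - φ x₀|
        = |((∫ y, φ (y + B t) * G t y) - ∫ y, φ y * G t y) + ((∫ y, φ y * G t y) - φ x₀)| := by
          ring_nf
      _ ≤ |(∫ y, φ (y + B t) * G t y) - ∫ y, φ y * G t y| + |(∫ y, φ y * G t y) - φ x₀| :=
          abs_add_le _ _
      _ < (2 * ε' + ε') + ε' := by linarith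
      _ = ε := by rw [hε']; ring

omit [FiniteDimensional ℝ E] [MeasurableSpace E] [BorelSpace E] in
/-- **Gaussian comparability is wobble-invariant on the parabolic scale**: if `G` is two-sided
Gaussian-comparable about the pole `(T, x₀)` and the shift obeys `‖B(t)‖² ≤ β (T − t)` — automatic
for a Type-I wobble, `‖B′‖ ≤ C_B/√(T−t)`, `B(T) = 0` — then so is `G̃(t,x) = G(t, x − B(t))`, with
constants `(c₁e^{−2β/c₂}, c₂/2, C₁e^{β/C₂}, 2C₂)`. -/
theorem isGaussianComparable_wobble {β : ℝ} (hG : IsGaussianComparable G (Iio T) T x₀)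
    (hBsq : ∀ t < T, ‖B t‖ ^ 2 ≤ β * (T - t)) :
    IsGaussianComparable (wobbleKernel G B) (Iio T) T x₀ := by
  obtain ⟨c₁, c₂, C₁, C₂, hc₁, hc₂, hC₁, hC₂, h⟩ := hG
  refine ⟨c₁ * Real.exp (-(2 * β) / c₂), c₂ / 2, C₁ * Real.exp (β / C₂), 2 * C₂, by positivity,
    by positivity, by positivity, by positivity, fun t ht x => ?_⟩
  have hTt : 0 < T - t := sub_pos.2 ht
  obtain ⟨hlo, hhi⟩ := h t ht (x - B t)
  have hB := hBsq t ht
  set n : ℝ := (Module.finrank ℝ E : ℝ)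
  set P : ℝ := (T - t) ^ (-n / 2) with hP
  have hP0 : 0 < P := Real.rpow_pos_of_pos hTt _
  -- the two parallelogram-type inequalities
  have h1 : ‖x - B t - x₀‖ ^ 2 ≤ 2 * ‖x - x₀‖ ^ 2 + 2 * ‖B t‖ ^ 2 := by
    have hle : ‖x - B t - x₀‖ ≤ ‖x - x₀‖ + ‖B t‖ := by
      have : x - B t - x₀ = (x - x₀) - B t := by abel
      rw [this]; exact norm_sub_le _ _
    have hsq := pow_le_pow_left₀ (norm_nonneg _) hle 2
    nlinarith [sq_nonneg (‖x - x₀‖ - ‖B t‖)]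
  have h2 : ‖x - x₀‖ ^ 2 ≤ 2 * ‖x - B t - x₀‖ ^ 2 + 2 * ‖B t‖ ^ 2 := by
    have hle : ‖x - x₀‖ ≤ ‖x - B t - x₀‖ + ‖B t‖ := by
      have : x - x₀ = (x - B t - x₀) + B t := by abel
      rw [this]; exact norm_add_le _ _
    have hsq := pow_le_pow_left₀ (norm_nonneg _) hle 2
    nlinarith [sq_nonneg (‖x - B t - x₀‖ - ‖B t‖)]
  constructor
  · -- lower bound
    show c₁ * Real.exp (-(2 * β) / c₂) * (T - t) ^ (-n / 2) *
        Real.exp (-(‖x - x₀‖ ^ 2) / (c₂ / 2 * (T - t))) ≤ G t (x - B t)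
    refine le_trans ?_ hlo
    rw [show c₁ * Real.exp (-(2 * β) / c₂) * (T - t) ^ (-n / 2) *
        Real.exp (-(‖x - x₀‖ ^ 2) / (c₂ / 2 * (T - t))) =
        c₁ * (T - t) ^ (-n / 2) * (Real.exp (-(2 * β) / c₂) *
          Real.exp (-(‖x - x₀‖ ^ 2) / (c₂ / 2 * (T - t)))) by ring, ← Real.exp_add]
    refine mul_le_mul_of_nonneg_left (Real.exp_le_exp.2 ?_) (by positivity)
    rw [div_add_div _ _ hc₂.ne' (by positivity), div_le_div_iff₀ (by positivity) (by positivity)]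
    have hc2T : 0 < c₂ * (T - t) := by positivity
    nlinarith [mul_le_mul_of_nonneg_left h1 hc2T.le, mul_le_mul_of_nonneg_left hB hc₂.le,
      mul_pos hc₂ hc2T]
  · -- upper bound
    show G t (x - B t) ≤ C₁ * Real.exp (β / C₂) * (T - t) ^ (-n / 2) *
        Real.exp (-(‖x - x₀‖ ^ 2) / (2 * C₂ * (T - t)))
    refine hhi.trans ?_
    rw [show C₁ * Real.exp (β / C₂) * (T - t) ^ (-n / 2) *
        Real.exp (-(‖x - x₀‖ ^ 2) / (2 * C₂ * (T - t))) =
        C₁ * (T - t) ^ (-n / 2) * (Real.exp (β / C₂) *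
          Real.exp (-(‖x - x₀‖ ^ 2) / (2 * C₂ * (T - t)))) by ring, ← Real.exp_add]
    refine mul_le_mul_of_nonneg_left (Real.exp_le_exp.2 ?_) (by positivity)
    rw [div_add_div _ _ hC₂.ne' (by positivity), le_div_iff₀ (by positivity),
      div_mul_eq_mul_div, div_le_iff₀ (by positivity)]
    have hC2T : 0 < C₂ * (T - t) := by positivity
    nlinarith [mul_le_mul_of_nonneg_left h2 hC2T.le, mul_le_mul_of_nonneg_left hB hC₂.le,
      mul_pos hC₂ hC2T]

/-! ### The model case with transport: the translating backward heat kernel of a parasitic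
Type-I drift -/

/-- **The translating backward heat kernel is adapted to the parasitic Type-I drift** (non-vacuity
of the kernel clauses WITH transport, `DK·v ≢ 0`): for `v(t, x) = −(b/√(T−t)) e` (smooth,
divergence-free, Type-I with constant `|b|‖e‖`, classical NS with pressure `−⟪B″(t), x⟫`), the
kernel `Γ_{ν(T−t)}(x − 2b√(T−t)e − x₀)` satisfies all five clauses at the pole `(T, x₀)`. -/
theorem isAdaptedBackwardKernel_parasiticDrift (hν : 0 < ν) (T b : ℝ) (x₀ e : E) :
    IsAdaptedBackwardKernel ν (fun t _ => parasiticDrift T b e t) (Iio T) T x₀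
      (wobbleKernel (backwardHeatKernel ν T x₀) (parabolicShift T b e)) := by
  have h := isAdaptedBackwardKernel_wobble (isAdaptedBackwardKernel_backwardHeatKernel hν T x₀)
    (contDiffOn_parabolicShift T b e) (fun t ht => hasDerivAt_parabolicShift b e ht)
    (tendsto_parabolicShift T b e)
  rwa [wobbleDrift_zero] at h

omit [FiniteDimensional ℝ E] [MeasurableSpace E] [BorelSpace E] in
/-- … and it is two-sided Gaussian-comparable about the pole. -/
theorem isGaussianComparable_parasiticDrift (hν : 0 < ν) (T b : ℝ) (x₀ e : E) :
    IsGaussianComparable (wobbleKernel (backwardHeatKernel ν T x₀) (parabolicShift T b e))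
      (Iio T) T x₀ :=
  isGaussianComparable_wobble (β := 4 * b ^ 2 * ‖e‖ ^ 2)
    (isGaussianComparable_backwardHeatKernel hν T x₀) fun _ ht => (norm_parabolicShift_sq T b e ht).le

end Wobble

end Summit.NavierStokesRegularity.NavierStokesRegularity.Theorems.FrequencyRigidity.Negative

end
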